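import Literature.AlgebraicGeometry.Motives.HypersurfaceLinearSections
import HarnessLib

/-!
# Linear sections of a hypersurface on which its equation splits: `[X ∩ M] = Σ_t [Π_t]`

A companion to `Motives/HypersurfaceLinearSections` (`[X ∩ M] = H_X^c ∩ [X]` in `CH_*(X)` for a
hypersurface `X = V₊(F) ⊆ ℙ^{d+1}` and a linear subspace `M = V₊(L₁, …, L_c) ⊄ X`; Mboro,
arXiv:1701.04488, proof of Prop. 1.4, p. 8: "`H_X^{n-2} = [S]`", `S = P₀ ∩ X` a cubic surface). When
the equation of `X` splits on `M` into linear factors — `F ≡ ℓ₁ ⋯ ℓ_e mod 𝔭_M` — the section cycle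
`[X ∩ M] = V₊(F) · [M]` is the sum of the linear subspaces `Π_t = M ∩ V₊(ℓ_t)` with multiplicity one
each (Fulton, *Intersection Theory*, Def. 2.3, Prop. 2.3 (b), Example 2.5.1), so that
`Σ_t [Π_t] = c₁(𝒪_X(1))ᶜ ∩ [X]` in `CH_{d-c}(X)`; for a cubic and a `3`-plane meeting it in three
planes this is the relation `[Π₁] + [Π₂] + [Π₃] = H_X^{n-2} ∩ [X]` in `CH₂(X)` among the plane
classes of `Mboro2018_chowTwo_cubic` (`Motives/LinearSubspacesGenerateChow`).

* `ProjSpace.formDivisor_mul_sameDivisor` — `V₊(F G) = V₊(F) + V₊(G)` as Cartier divisors;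
  `ProjSpace.primeInter_formDivisor_mul`, `ProjSpace.primeInter_formDivisor_prod_linear` —
  **`V₊(F G) · [V] = V₊(F) · [V] + V₊(G) · [V]`**, `V₊(ℓ₁ ⋯ ℓ_m) · [V] = Σ_t V₊(ℓ_t) · [V]`;
* `ProjSpace.pullbackFn_ofPoint_formToFunctionField_congr`, `ProjSpace.primeInter_formDivisor_congr` —
  **`V₊(F) · [V] = V₊(G) · [V]` for `F ≡ G mod 𝔭_V`** of the same degree (the restricted divisors
  have the same local equations);
* `Hypersurface.iterInter_primeCycle_eq_sum_primeCycle_of_sub_prod_mem` — **`[X ∩ M] = Σ_t [Π_t]` as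
  cycles on `X`**; `Hypersurface.exists_toIdeal_base_eq_span_snoc` — the `Π_t` lie on `X` and are
  `(d - c)`-planes of `X`; `Hypersurface.sum_mk_primeCycle_eq_hyperplaneSectionOnIter` —
  **`Σ_t [Π_t] = c₁(𝒪_X(1))ᶜ ∩ [X]`**;
* `ProjSpace.exists_sub_mul_mul_mem_idealSpan_of_cubic` — a cubic form vanishing on two hyperplanes
  `V(L, ℓ) ⊄ V(L, ℓ')` of `V(L)` satisfies `F ≡ ℓ ℓ' q mod (L)`, `q` linear;
  `Hypersurface.exists_residual_plane_of_cubic` — **for a cubic hypersurface, two such linear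
  subspaces `Π, Π' ⊂ X ∩ M` have a residual one `Π'' ⊂ X ∩ M` with
  `[Π] + [Π'] + [Π''] = c₁(𝒪_X(1))ᶜ ∩ [X]`** (three planes of a cubic spanning a `3`-plane).

Everything is proved; no definitions, no named facts.

## References

* W. Fulton, *Intersection Theory*, 2nd ed., Springer (1998): Def. 2.3 (p. 33), Prop. 2.3 (b)
  (p. 34), Example 2.5.1 (p. 41). [Fulton1998]
* R. Mboro, *Remarks on the CH₂ of cubic hypersurfaces*, Geom. Dedicata (2019),
  doi:10.1007/s10711-018-0355-0, arXiv:1701.04488: proof of Prop. 1.4 (p. 8). [Mboro2018]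
-/

noncomputable section

universe u

open CategoryTheory AlgebraicGeometry Order Topology IsLocalRing
open Literature.AlgebraicGeometry.Motives.RatFn Literature.RingTheory.OrderOfVanishing
open Literature.AlgebraicGeometry.Motives.Segre

attribute [local instance] MvPolynomial.gradedAlgebra

namespace Literature.AlgebraicGeometry.Motives


namespace ProjSpace

open HomogeneousLocalization

variable {N : ℕ} {K : Type u} [Field K]

/-- `formDivisor` depends only on the form (transport of the proof arguments). [folklore] -/
theorem formDivisor_congr {e e' : ℕ} {F G : MvPolynomial (Fin (N + 1)) K} (h : F = G)
    (hF : F ∈ grading (Fin (N + 1)) K e) (hF0 : F ≠ 0) (hG : G ∈ grading (Fin (N + 1)) K e')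
    (hG0 : G ≠ 0) (hee' : e = e') : formDivisor F hF hF0 = formDivisor G hG hG0 := by
  subst h hee'
  rfl

/-- The algebra behind `V₊(F G) = V₊(F) + V₊(G)`: `u^{e+e'} (a b) / (v₁ᵉ a · v₂^{e'} b) =
(u/v₁)ᵉ (u/v₂)^{e'}`. [folklore] -/
theorem pow_add_mul_div_eq {L : Type*} [Field L] {e e' : ℕ} (u v₁ v₂ : L) {a b : L}
    (ha : a ≠ 0) (hb : b ≠ 0) :
    u ^ (e + e') * (a * b) / (v₁ ^ e * a * (v₂ ^ e' * b)) = (u / v₁) ^ e * (u / v₂) ^ e' := by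
  have hden : v₁ ^ e * a * (v₂ ^ e' * b) = v₁ ^ e * v₂ ^ e' * (a * b) := by ring
  rw [div_pow, div_pow, div_mul_div_comm, ← pow_add, hden, mul_div_mul_right _ _ (mul_ne_zero ha hb)]

/-- **`V₊(F G)` is the divisor `V₊(F) + V₊(G)`** (same local equations `F G / x_l^{e+e'} =
F/x_lᵉ · G/x_l^{e'}`). [folklore] -/
theorem formDivisor_mul_sameDivisor {e e' : ℕ} {F G : MvPolynomial (Fin (N + 1)) K}
    (hF : F ∈ grading (Fin (N + 1)) K e) (hF0 : F ≠ 0) (hG : G ∈ grading (Fin (N + 1)) K e')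
    (hG0 : G ≠ 0) :
    (formDivisor (F * G) (SetLike.mul_mem_graded hF hG) (mul_ne_zero hF0 hG0)).SameDivisor
      (formDivisor F hF hF0 + formDivisor G hG hG0) := by
  rintro ⟨i, u⟩ ⟨⟨j₁, u₁⟩, ⟨j₂, u₂⟩⟩ y hp hq
  have hyp : y ∈ U i.down.1 :=
    (mem_formDivisor_U_iff (SetLike.mul_mem_graded hF hG) (mul_ne_zero hF0 hG0) (i, u)).1 hp
  have hyq1 : y ∈ U j₁.down.1 := (mem_formDivisor_U_iff hF hF0 (j₁, u₁)).1 hq.1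
  have hyq2 : y ∈ U j₂.down.1 := (mem_formDivisor_U_iff hG hG0 (j₂, u₂)).1 hq.2
  change IsUnitAt y ((hyperplane N K).f i ^ (e + e') * formToFunctionField 0 (F * G) /
    ((hyperplane N K).f j₁ ^ e * formToFunctionField 0 F *
      ((hyperplane N K).f j₂ ^ e' * formToFunctionField 0 G)))
  rw [map_mul, pow_add_mul_div_eq ((hyperplane N K).f i) ((hyperplane N K).f j₁) ((hyperplane N K).f j₂)
    (formToFunctionField_ne_zero 0 hF hF0) (formToFunctionField_ne_zero 0 hG hG0)]
  exact (((hyperplane N K).isUnitAt_div i j₁ y hyp hyq1).pow e).mul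
    (((hyperplane N K).isUnitAt_div i j₂ y hyp hyq2).pow e')

/-- **Forms congruent modulo `𝔭_w` restrict to the same rational functions on `closure {w}`**: for
forms `F, G` of the same degree `e ≥ 1` with `F - G ∈ 𝔭_w` and a chart `D₊(x_l) ∋ w`, the pull-backs
to the subvariety `closure {w}` of `F/x_lᵉ` and `G/x_lᵉ` coincide (the germ of `(F - G)/x_lᵉ` at `w`
lies in `𝔪_w`, the kernel of `𝒪_{ℙ,w} → K(closure {w})`). [folklore] -/
theorem pullbackFn_ofPoint_formToFunctionField_congr {e : ℕ} (he : 0 < e)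
    {F G : MvPolynomial (Fin (N + 1)) K} (hF : F ∈ grading (Fin (N + 1)) K e)
    (hG : G ∈ grading (Fin (N + 1)) K e) {w : P N K}
    (hFG : F - G ∈ w.asHomogeneousIdeal) (l : Fin (N + 1)) (hl : w ∈ U l) :
    pullbackFn (ClosedSubvariety.ofPoint (P N K) w).ι (formToFunctionField l F) =
      pullbackFn (ClosedSubvariety.ofPoint (P N K) w).ι (formToFunctionField l G) := by
  set V := ClosedSubvariety.ofPoint (P N K) w
  let v₀ : ↥V.carrier := ClosedSubvariety.ofPointPt w (specializes_refl w)
  -- germs at `w` of the sections `F/x_lᵉ`, `G/x_lᵉ`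
  obtain ⟨tF, eF⟩ : ∃ t : (P N K).presheaf.stalk w, formToFunctionField l F = toFunctionField w t :=
    ⟨((P N K).presheaf.germ (U l) w hl).hom (sec l (Away.mk _ (X_mem K l) e F (mem_smul_one hF))), by
      rw [formToFunctionField_of_mem l (mem_smul_one hF), toFunctionField_germ_sec l hl]⟩
  obtain ⟨tG, eG⟩ : ∃ t : (P N K).presheaf.stalk w, formToFunctionField l G = toFunctionField w t :=
    ⟨((P N K).presheaf.germ (U l) w hl).hom (sec l (Away.mk _ (X_mem K l) e G (mem_smul_one hG))), by
      rw [formToFunctionField_of_mem l (mem_smul_one hG), toFunctionField_germ_sec l hl]⟩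
  have eH : formToFunctionField l (F - G) = toFunctionField w (tF - tG) := by
    rw [map_sub, map_sub, eF, eG]
  -- `tF - tG` dies in `𝒪_{V, v₀} ⊆ K(V)`
  have hker : tF - tG ∈ RingHom.ker ((V.ι.stalkMap v₀).hom) := by
    rw [ClosedSubvariety.ker_stalkMap_ofPoint_ι w v₀]
    by_contra hnot
    have hu := (isUnitAt_toFunctionField_iff_notMem
      (ClosedSubvariety.specializes_ofPoint_ι w v₀) (tF - tG)).2 hnot
    have hu' : IsUnitAt w (formToFunctionField l (F - G)) := by
      rw [eH]
      exact hu
    exact (isUnitAt_formToFunctionField_iff l he (sub_mem hF hG) hl).1 hu' hFG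
  have kF : pullbackFn V.ι (toFunctionField w tF) = toFunctionField v₀ ((V.ι.stalkMap v₀).hom tF) :=
    pullbackFn_toFunctionField V.ι v₀ tF
  have kG : pullbackFn V.ι (toFunctionField w tG) = toFunctionField v₀ ((V.ι.stalkMap v₀).hom tG) :=
    pullbackFn_toFunctionField V.ι v₀ tG
  rw [eF, eG, kF, kG]
  congr 1
  rw [← sub_eq_zero, ← map_sub]
  exact hker

/-- **`V₊(F) · [V] = V₊(G) · [V]` for forms `F ≡ G mod 𝔭_V` of the same degree** (`V = closure {w}
⊄ V₊(F)`): the restrictions of the Cartier divisors `V₊(F)`, `V₊(G)` to `V` have the same local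
equations (`pullbackFn_ofPoint_formToFunctionField_congr`), hence the same Weil divisor; Fulton,
Def. 2.3: `D · [V] = [j^*D]` depends only on `j^*D`. [cite: Fulton1998, Def. 2.3 (p. 33)] -/
theorem primeInter_formDivisor_congr {e : ℕ} (he : 0 < e) {F G : MvPolynomial (Fin (N + 1)) K}
    (hF : F ∈ grading (Fin (N + 1)) K e) (hF0 : F ≠ 0) (hG : G ∈ grading (Fin (N + 1)) K e)
    (hG0 : G ≠ 0) {w : P N K} (hFw : F ∉ w.asHomogeneousIdeal) (hFG : F - G ∈ w.asHomogeneousIdeal) :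
    (formDivisor F hF hF0).primeInter (X := projectiveSpace N K) w =
      (formDivisor G hG hG0).primeInter (X := projectiveSpace N K) w := by
  have hGw : G ∉ w.asHomogeneousIdeal := by
    intro h
    apply hFw
    have := add_mem hFG h
    rwa [sub_add_cancel] at this
  set V := ClosedSubvariety.ofPoint (P N K) w
  have hgen : V.ι (genericPoint V.carrier) = w := by
    change V.genericPoint = w
    exact ClosedSubvariety.genericPoint_ofPoint w
  have hDF : (formDivisor F hF hF0).Avoids (V.ι (genericPoint V.carrier)) := by
    rw [hgen]; exact (formDivisor_avoids_iff hF hF0 he).2 hFw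
  have hDG : (formDivisor G hG hG0).Avoids (V.ι (genericPoint V.carrier)) := by
    rw [hgen]; exact (formDivisor_avoids_iff hG hG0 he).2 hGw
  change AlgebraicCycle.map V.ι height height ((formDivisor F hF hF0).pullbackRep V.ι).cycle =
    AlgebraicCycle.map V.ι height height ((formDivisor G hG hG0).pullbackRep V.ι).cycle
  rw [CartierDivisor.pullbackRep_of_avoids _ _ hDF, CartierDivisor.pullbackRep_of_avoids _ _ hDG]
  congr 1
  refine CartierDivisor.SameDivisor.cycle_eq ?_
  rintro ⟨⟨i, u⟩, hi⟩ ⟨⟨j, u'⟩, hj⟩ x hp hq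
  rw [CartierDivisor.pullbackAvoiding_f, CartierDivisor.pullbackAvoiding_f, formDivisor_f, formDivisor_f]
  change IsUnitAt x (pullbackFn V.ι (formToFunctionField i.down.1 F) /
    pullbackFn V.ι (formToFunctionField j.down.1 G))
  -- `w` lies in the chart of `j`
  have hj' : V.ι (genericPoint V.carrier) ∈ U j.down.1 := (mem_formDivisor_U_iff hG hG0 (j, u')).1 hj
  have hwj : w ∈ U j.down.1 := by rw [← hgen]; exact hj'
  rw [← pullbackFn_ofPoint_formToFunctionField_congr he hF hG hFG _ hwj]
  have hjF : V.ι (genericPoint V.carrier) ∈ (formDivisor F hF hF0).U (j, PUnit.unit) :=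
    (mem_formDivisor_U_iff hF hF0 _).2 hj'
  have hqF : x ∈ V.ι ⁻¹ᵁ (formDivisor F hF hF0).U (j, PUnit.unit) :=
    (mem_formDivisor_U_iff hF hF0 _).2 ((mem_formDivisor_U_iff hG hG0 (j, u')).1 hq)
  have key := ((formDivisor F hF hF0).pullbackAvoiding V.ι hDF).isUnitAt_div ⟨(i, u), hi⟩
    ⟨(j, PUnit.unit), hjF⟩ x hp hqF
  rw [CartierDivisor.pullbackAvoiding_f, CartierDivisor.pullbackAvoiding_f, formDivisor_f, formDivisor_f]
    at key
  exact key

/-- A product of elements outside the prime `𝔭_w` lies outside `𝔭_w`. [folklore] -/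
theorem prod_notMem_of_forall_notMem {ι : Type*} (s : Finset ι) (f : ι → MvPolynomial (Fin (N + 1)) K)
    {w : P N K} (h : ∀ i ∈ s, f i ∉ w.asHomogeneousIdeal) : (∏ i ∈ s, f i) ∉ w.asHomogeneousIdeal := by
  classical
  refine Finset.prod_induction f (fun x => x ∉ w.asHomogeneousIdeal) ?_ ?_ h
  · intro a b ha hb hab
    rcases w.isPrime.mem_or_mem (show a * b ∈ w.asHomogeneousIdeal.toIdeal from hab) with h1 | h2
    · exact ha h1
    · exact hb h2
  · intro h1
    exact w.isPrime.ne_top ((Ideal.eq_top_iff_one _).2 h1)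

/-- **`V₊(F G) · [V] = V₊(F) · [V] + V₊(G) · [V]`** for `V ⊄ V₊(F) ∪ V₊(G)` (Fulton, Prop. 2.3 (b):
`(D + D') · α = D · α + D' · α`, at the level of cycles on the components off the supports).
[cite: Fulton1998, Prop. 2.3 (b) (p. 34)] -/
theorem primeInter_formDivisor_mul {e e' : ℕ} (he : 0 < e) (he' : 0 < e')
    {F G : MvPolynomial (Fin (N + 1)) K} (hF : F ∈ grading (Fin (N + 1)) K e) (hF0 : F ≠ 0)
    (hG : G ∈ grading (Fin (N + 1)) K e') (hG0 : G ≠ 0) {w : P N K}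
    (hFw : F ∉ w.asHomogeneousIdeal) (hGw : G ∉ w.asHomogeneousIdeal) :
    (formDivisor (F * G) (SetLike.mul_mem_graded hF hG) (mul_ne_zero hF0 hG0)).primeInter
        (X := projectiveSpace N K) w =
      (formDivisor F hF hF0).primeInter (X := projectiveSpace N K) w +
        (formDivisor G hG hG0).primeInter (X := projectiveSpace N K) w := by
  have hFGw : (formDivisor (F * G) (SetLike.mul_mem_graded hF hG) (mul_ne_zero hF0 hG0)).Avoids w := by
    refine (formDivisor_avoids_iff _ _ (Nat.add_pos_left he e')).2 fun h => ?_
    rcases w.isPrime.mem_or_mem (show F * G ∈ w.asHomogeneousIdeal.toIdeal from h) with h1 | h2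
    · exact hFw h1
    · exact hGw h2
  exact ((formDivisor_mul_sameDivisor hF hF0 hG hG0).primeInter_eq (X := projectiveSpace N K) hFGw).trans
    (CartierDivisor.primeInter_add (X := projectiveSpace N K)
      ((formDivisor_avoids_iff hF hF0 he).2 hFw) ((formDivisor_avoids_iff hG hG0 he').2 hGw))

/-- A product of `m` linear forms is a form of degree `m`. [folklore] -/
theorem prod_mem_grading_of_linear {m : ℕ} (ℓ : Fin m → MvPolynomial (Fin (N + 1)) K)
    (hℓ : ∀ t, ℓ t ∈ grading (Fin (N + 1)) K 1) : (∏ t, ℓ t) ∈ grading (Fin (N + 1)) K m := by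
  have h := MvPolynomial.IsHomogeneous.prod (Finset.univ : Finset (Fin m)) ℓ (fun _ => 1)
    (fun t _ => (MvPolynomial.mem_homogeneousSubmodule 1 _).1 (hℓ t))
  rw [Finset.sum_const, Finset.card_univ, Fintype.card_fin, smul_eq_mul, mul_one] at h
  exact (MvPolynomial.mem_homogeneousSubmodule m _).2 h

/-- **`V₊(ℓ₁ ⋯ ℓ_m) · [V] = Σ_t V₊(ℓ_t) · [V]`** for linear forms `ℓ_t ∉ 𝔭_V` (Fulton, Prop. 2.3 (b),
iterated). [cite: Fulton1998, Prop. 2.3 (b) (p. 34)] -/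
theorem primeInter_formDivisor_prod_linear :
    ∀ {m : ℕ} (ℓ : Fin (m + 1) → MvPolynomial (Fin (N + 1)) K)
      (hℓ : ∀ t, ℓ t ∈ grading (Fin (N + 1)) K 1) (hP : (∏ t, ℓ t) ∈ grading (Fin (N + 1)) K (m + 1))
      (hP0 : (∏ t, ℓ t) ≠ 0) {w : P N K} (_hℓw : ∀ t, ℓ t ∉ w.asHomogeneousIdeal),
      (formDivisor (∏ t, ℓ t) hP hP0).primeInter (X := projectiveSpace N K) w =
        ∑ t, (formDivisor (ℓ t) (hℓ t)
          (fun h => hP0 (Finset.prod_eq_zero (Finset.mem_univ t) h))).primeInter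
            (X := projectiveSpace N K) w
  | 0, ℓ, hℓ, hP, hP0, w, hℓw => by
    have h1 : formDivisor (∏ t, ℓ t) hP hP0 =
        formDivisor (ℓ 0) (hℓ 0) (fun h => hP0 (Finset.prod_eq_zero (Finset.mem_univ 0) h)) :=
      formDivisor_congr (Fin.prod_univ_one ℓ) hP hP0 (hℓ 0) _ rfl
    rw [Fin.sum_univ_one, h1]
  | m + 1, ℓ, hℓ, hP, hP0, w, hℓw => by
    have hℓ0 : ∀ t, ℓ t ≠ 0 := fun t h => hP0 (Finset.prod_eq_zero (Finset.mem_univ t) h)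
    have hP' : (∏ t : Fin (m + 1), ℓ t.castSucc) ∈ grading (Fin (N + 1)) K (m + 1) :=
      prod_mem_grading_of_linear _ fun t => hℓ _
    have hP'0 : (∏ t : Fin (m + 1), ℓ t.castSucc) ≠ 0 :=
      Finset.prod_ne_zero_iff.2 fun t _ => hℓ0 _
    have hP'w : (∏ t : Fin (m + 1), ℓ t.castSucc) ∉ w.asHomogeneousIdeal :=
      prod_notMem_of_forall_notMem _ _ fun t _ => hℓw _
    have IH := primeInter_formDivisor_prod_linear (fun t : Fin (m + 1) => ℓ t.castSucc) (fun t => hℓ _)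
      hP' hP'0 (w := w) (fun t => hℓw _)
    have hprod : (∏ t, ℓ t) = (∏ t : Fin (m + 1), ℓ t.castSucc) * ℓ (Fin.last (m + 1)) :=
      Fin.prod_univ_castSucc ℓ
    have h1 : formDivisor (∏ t, ℓ t) hP hP0 = formDivisor ((∏ t : Fin (m + 1), ℓ t.castSucc) * ℓ (Fin.last (m + 1)))
        (SetLike.mul_mem_graded hP' (hℓ _)) (mul_ne_zero hP'0 (hℓ0 _)) :=
      formDivisor_congr hprod hP hP0 _ _ rfl
    rw [h1, primeInter_formDivisor_mul (Nat.succ_pos m) one_pos hP' hP'0 (hℓ _) (hℓ0 _) hP'w (hℓw _),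
      Fin.sum_univ_castSucc]
    congr 1

end ProjSpace

/-! ### Sections of a hypersurface splitting into linear subspaces -/

section ClosedImmersionCycles

/-- Push-forward of cycles along a closed immersion is injective (`(ι_* c)(ι z) = c z`). [folklore] -/
theorem algebraicCycleMap_injective_of_isClosedImmersion {W Y : Scheme.{u}} (ι : W ⟶ Y)
    [IsClosedImmersion ι] {c c' : AlgebraicCycle W ℤ}
    (h : AlgebraicCycle.map ι height height c = AlgebraicCycle.map ι height height c') : c = c' := by
  ext z
  rw [← algebraicCycleMap_apply_base_of_isClosedImmersion ι c z,
    ← algebraicCycleMap_apply_base_of_isClosedImmersion ι c' z, h]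

end ClosedImmersionCycles

namespace Hypersurface

variable {K : Type u} [Field K] {d e : ℕ} {X : SchemeOver K} [IsIntegral X.left]
  [LocallyOfFiniteType X.hom] (i : X ⟶ projectiveSpace (d + 1) K) [IsClosedImmersion i.left]
  {F : MvPolynomial (Fin (d + 1 + 1)) K} (hF : F ∈ grading (Fin (d + 1 + 1)) K e) (hprime : Prime F)
  (hrange : Set.range i.left.base =
    ProjectiveSpectrum.zeroLocus (MvPolynomial.homogeneousSubmodule (Fin (d + 1 + 1)) K) {F})

open ProjSpace

/-- Linear independence of `(L, ℓ)` from `ℓ ∉ (L)`. [folklore] -/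
theorem linearIndependent_snoc_of_notMem_idealSpan {c : ℕ} {L : Fin c → MvPolynomial (Fin (d + 1 + 1)) K}
    (hLind : LinearIndependent K L) {ℓ : MvPolynomial (Fin (d + 1 + 1)) K}
    (hℓ : ℓ ∉ Ideal.span (Set.range L)) : LinearIndependent K (Fin.snoc L ℓ) := by
  refine linearIndependent_finSnoc.2 ⟨hLind, fun h => hℓ ?_⟩
  have hle : Submodule.span K (Set.range L) ≤ (Ideal.span (Set.range L)).restrictScalars K :=
    Submodule.span_le.mpr Ideal.subset_span
  exact hle h

include hF hprime hrange

/-- **`[X ∩ M] = Σ_t [Π_t]` as cycles on `X`, when the equation of `X` splits on `M` into linear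
factors.** Let `i : X ≅ V₊(F) ⊆ ℙ^{d+1}` (`F` prime of degree `e ≥ 1`), `M = V₊(L₁, …, L_c)` a linear
subspace (generic point `w`, `c + 1 ≤ d + 1`) not contained in `X`, and suppose
`F ≡ ℓ₁ ⋯ ℓ_e mod 𝔭_M` for linear forms `ℓ_t`. Let `z_t ∈ X` be the points with
`i(z_t)` the generic point of the linear subspace `Π_t = V₊(L₁, …, L_c, ℓ_t) = M ∩ V₊(ℓ_t)`. Then the
iterated section cycle `(i^*V₊(L_c)) ⋯ (i^*V₊(L₁)) · [X]` — the cycle `[X ∩ M]`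
(`map_iterInter_primeCycle_eq_primeInter`) — equals `Σ_t [closure {z_t}]`: indeed
`V₊(F) · [M] = V₊(ℓ₁ ⋯ ℓ_e) · [M] = Σ_t V₊(ℓ_t) · [M] = Σ_t [Π_t]` (Fulton, Def. 2.3 and Prop. 2.3 (b),
Example 2.5.1), and `i_*` is injective on cycles. For a cubic (`e = 3`) and a `3`-plane `M`
(`c = d - 2`) this is the decomposition of the cubic surface `X ∩ M` into three planes.
[cite: Fulton1998, Def. 2.3, Prop. 2.3 (b) and Example 2.5.1 (pp. 33–41)] -/
theorem iterInter_primeCycle_eq_sum_primeCycle_of_sub_prod_mem {c : ℕ}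
    (L : Fin c → MvPolynomial (Fin (d + 1 + 1)) K) (hL : ∀ k, L k ∈ grading (Fin (d + 1 + 1)) K 1)
    (hLind : LinearIndependent K L) (hc : c + 1 ≤ d + 1)
    (hav : ∀ k, (formDivisor (L k) (hL k) (hLind.ne_zero k)).Avoids (i.left.base (genericPoint ↥X.left)))
    {w : ↥(projectiveSpace (d + 1) K).left}
    (hw : (ProjectiveSpectrum.asHomogeneousIdeal
      (𝒜 := MvPolynomial.homogeneousSubmodule (Fin (d + 1 + 1)) K) w).toIdeal = Ideal.span (Set.range L))
    (hFw : F ∉ ProjectiveSpectrum.asHomogeneousIdeal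
      (𝒜 := MvPolynomial.homogeneousSubmodule (Fin (d + 1 + 1)) K) w)
    (ℓ : Fin e → MvPolynomial (Fin (d + 1 + 1)) K) (hℓ : ∀ t, ℓ t ∈ grading (Fin (d + 1 + 1)) K 1)
    (hcong : F - ∏ t, ℓ t ∈ ProjectiveSpectrum.asHomogeneousIdeal
      (𝒜 := MvPolynomial.homogeneousSubmodule (Fin (d + 1 + 1)) K) w)
    (z : Fin e → ↥X.left)
    (hz : ∀ t, (ProjectiveSpectrum.asHomogeneousIdeal
      (𝒜 := MvPolynomial.homogeneousSubmodule (Fin (d + 1 + 1)) K) (i.left.base (z t))).toIdeal =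
        Ideal.span (Set.range (Fin.snoc L (ℓ t)))) :
    CartierDivisor.iterInter c
        (fun k => (formDivisor (L k) (hL k) (hLind.ne_zero k)).pullbackAvoiding i.left (hav k))
        (primeCycle (genericPoint ↥X.left)) =
      ∑ t, primeCycle (z t) := by
  have he : 0 < e := pos_of_mem_grading_of_prime hF hprime
  obtain ⟨m', rfl⟩ : ∃ m', e = m' + 1 := ⟨e - 1, (Nat.succ_pred_eq_of_pos he).symm⟩
  -- the product `ℓ₁ ⋯ ℓ_e`
  have hP : (∏ t, ℓ t) ∈ grading (Fin (d + 1 + 1)) K (m' + 1) := prod_mem_grading_of_linear ℓ hℓ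
  have hprodw : (∏ t, ℓ t) ∉ ProjectiveSpectrum.asHomogeneousIdeal
      (𝒜 := MvPolynomial.homogeneousSubmodule (Fin (d + 1 + 1)) K) w := by
    intro h
    apply hFw
    have := add_mem hcong h
    rwa [sub_add_cancel] at this
  have hP0 : (∏ t, ℓ t) ≠ 0 := by
    intro h
    rw [h] at hprodw
    exact hprodw (zero_mem _)
  have hℓw : ∀ t, ℓ t ∉ ProjectiveSpectrum.asHomogeneousIdeal
      (𝒜 := MvPolynomial.homogeneousSubmodule (Fin (d + 1 + 1)) K) w := by
    intro t h
    apply hprodw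
    obtain ⟨q, hq⟩ := Finset.dvd_prod_of_mem ℓ (Finset.mem_univ t)
    rw [hq]
    exact Ideal.mul_mem_right q _ h
  -- `V₊(F) · [M] = V₊(ℓ₁ ⋯ ℓ_e) · [M] = Σ_t V₊(ℓ_t) · [M]`
  have h1 := primeInter_formDivisor_congr (N := d + 1) he hF hprime.ne_zero hP hP0 (w := w) hFw hcong
  have h2 := primeInter_formDivisor_prod_linear (N := d + 1) ℓ hℓ hP hP0 (w := w) hℓw
  -- `V₊(ℓ_t) · [M] = [Π_t]`
  have h3 : ∀ t, (formDivisor (ℓ t) (hℓ t)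
      (fun h => hP0 (Finset.prod_eq_zero (Finset.mem_univ t) h))).primeInter
        (X := projectiveSpace (d + 1) K) w = primeCycle (i.left.base (z t)) := by
    intro t
    have hind : LinearIndependent K (Fin.snoc L (ℓ t)) :=
      linearIndependent_snoc_of_notMem_idealSpan hLind (fun h => hℓw t (by
        change ℓ t ∈ (ProjectiveSpectrum.asHomogeneousIdeal
          (𝒜 := MvPolynomial.homogeneousSubmodule (Fin (d + 1 + 1)) K) w).toIdeal
        rw [hw]; exact h))
    have hgr : ∀ k, Fin.snoc (α := fun _ => MvPolynomial (Fin (d + 1 + 1)) K) L (ℓ t) k ∈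
        grading (Fin (d + 1 + 1)) K 1 := fun k => by
      refine Fin.lastCases ?_ (fun j => ?_) k
      · rw [Fin.snoc_last]; exact hℓ t
      · rw [Fin.snoc_castSucc]; exact hL j
    have hw₀ : (ProjectiveSpectrum.asHomogeneousIdeal
        (𝒜 := MvPolynomial.homogeneousSubmodule (Fin (d + 1 + 1)) K) w).toIdeal =
          Ideal.span (Set.range (fun k : Fin c =>
            Fin.snoc (α := fun _ => MvPolynomial (Fin (d + 1 + 1)) K) L (ℓ t) k.castSucc)) := by
      simp only [Fin.snoc_castSucc]
      exact hw
    have key := primeInter_formDivisor_last_eq_primeCycle (N := d + 1) (Fin.snoc L (ℓ t)) hgr hind hc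
      hw₀ (hz t)
    rw [← key]
    congr 1
    exact formDivisor_congr
      (Fin.snoc_last (α := fun _ => MvPolynomial (Fin (d + 1 + 1)) K) (ℓ t) L).symm _ _ _ _ rfl
  -- assemble on `ℙ^{d+1}` and pull back to `X`
  haveI : CompactSpace ↥X.left := i.left.isClosedEmbedding.compactSpace
  refine algebraicCycleMap_injective_of_isClosedImmersion i.left ?_
  rw [map_iterInter_primeCycle_eq_primeInter i hF hprime hrange c L hL hLind (by omega) hav w hw hFw]
  refine (h1.trans h2).trans ?_
  have hΦ : AlgebraicCycle.map i.left height height (∑ t, primeCycle (z t)) =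
      ∑ t, AlgebraicCycle.map i.left height height (primeCycle (z t)) :=
    map_sum (AddMonoidHom.mk' (AlgebraicCycle.map i.left height height) (algebraicCycleMap_add i.left _ _))
      _ _
  rw [hΦ]
  refine Finset.sum_congr rfl fun t _ => ?_
  rw [h3 t, algebraicCycleMap_primeCycle]

omit [IsIntegral X.left] [LocallyOfFiniteType X.hom] hF hprime hrange in
/-- **A point of `X` over an `r`-plane point of `ℙ^{d+1}` is an `r`-plane point of `X`** (w.r.t. the
closed immersion `i`): closed immersions preserve dimensions of point closures and
`i '' closure {z} = closure {i z}`. [folklore] -/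
theorem isLinearSubspacePoint_of_toIdeal_base_eq_span {t' : ℕ} (L' : Fin t' → MvPolynomial (Fin (d + 1 + 1)) K)
    (hL' : LinearIndependent K L') (hhom : ∀ j, (L' j).IsHomogeneous 1) (ht' : t' ≤ d + 1) {z : ↥X.left}
    (hz : (ProjectiveSpectrum.asHomogeneousIdeal
      (𝒜 := MvPolynomial.homogeneousSubmodule (Fin (d + 1 + 1)) K) (i.left.base z)).toIdeal =
        Ideal.span (Set.range L')) :
    IsLinearSubspacePoint (d + 1 - t') (d + 1) i z := by
  have h := ProjSpace.isLinearSubspacePoint_of_toIdeal_eq_span L' hL' hhom ht' hz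
  refine ⟨(height_base_eq_of_isClosedImmersion' i.left z).symm.trans h.1, ?_⟩
  obtain ⟨L, hL, hhom', hcl⟩ := h.2
  refine ⟨L, hL, hhom', ?_⟩
  have himg : ⇑i.left.base '' closure {z} = closure {i.left.base z} := by
    rw [← i.left.isClosedEmbedding.closure_image_eq, Set.image_singleton]
  change id '' closure {i.left.base z} = _ at hcl
  rw [Set.image_id] at hcl
  rw [himg]
  exact hcl

omit [IsIntegral X.left] [LocallyOfFiniteType X.hom] [IsClosedImmersion i.left] hF hprime hrange in
/-- The extended family `(L, ℓ)` consists of linear forms. [folklore] -/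
theorem snoc_mem_grading {c : ℕ} {L : Fin c → MvPolynomial (Fin (d + 1 + 1)) K}
    (hL : ∀ k, L k ∈ grading (Fin (d + 1 + 1)) K 1) {ℓ : MvPolynomial (Fin (d + 1 + 1)) K}
    (hℓ : ℓ ∈ grading (Fin (d + 1 + 1)) K 1) (k : Fin (c + 1)) :
    Fin.snoc (α := fun _ => MvPolynomial (Fin (d + 1 + 1)) K) L ℓ k ∈ grading (Fin (d + 1 + 1)) K 1 := by
  refine Fin.lastCases ?_ (fun j => ?_) k
  · rw [Fin.snoc_last]; exact hℓ
  · rw [Fin.snoc_castSucc]; exact hL j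

omit [IsIntegral X.left] [LocallyOfFiniteType X.hom] hF hprime in
/-- **The linear components `Π_t = M ∩ V₊(ℓ_t)` lie on `X` and are `(d - c)`-planes of `X`**: under
the hypotheses of `iterInter_primeCycle_eq_sum_primeCycle_of_sub_prod_mem`, for each `t` there is a
point `z_t ∈ X` whose image is the generic point of `V₊(L₁, …, L_c, ℓ_t)`, and every such point is a
`(d + 1 - (c + 1))`-plane point of `X`. [folklore] -/
theorem exists_toIdeal_base_eq_span_snoc {c : ℕ}
    (L : Fin c → MvPolynomial (Fin (d + 1 + 1)) K) (hL : ∀ k, L k ∈ grading (Fin (d + 1 + 1)) K 1)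
    (hLind : LinearIndependent K L) (hc : c + 1 ≤ d + 1)
    {w : ↥(projectiveSpace (d + 1) K).left}
    (hw : (ProjectiveSpectrum.asHomogeneousIdeal
      (𝒜 := MvPolynomial.homogeneousSubmodule (Fin (d + 1 + 1)) K) w).toIdeal = Ideal.span (Set.range L))
    (hFw : F ∉ ProjectiveSpectrum.asHomogeneousIdeal
      (𝒜 := MvPolynomial.homogeneousSubmodule (Fin (d + 1 + 1)) K) w)
    (ℓ : Fin e → MvPolynomial (Fin (d + 1 + 1)) K) (hℓ : ∀ t, ℓ t ∈ grading (Fin (d + 1 + 1)) K 1)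
    (hcong : F - ∏ t, ℓ t ∈ ProjectiveSpectrum.asHomogeneousIdeal
      (𝒜 := MvPolynomial.homogeneousSubmodule (Fin (d + 1 + 1)) K) w) (t : Fin e) :
    ∃ z : ↥X.left, (ProjectiveSpectrum.asHomogeneousIdeal
        (𝒜 := MvPolynomial.homogeneousSubmodule (Fin (d + 1 + 1)) K) (i.left.base z)).toIdeal =
          Ideal.span (Set.range (Fin.snoc L (ℓ t))) ∧
      IsLinearSubspacePoint (d + 1 - (c + 1)) (d + 1) i z := by
  have hprodw : (∏ t, ℓ t) ∉ ProjectiveSpectrum.asHomogeneousIdeal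
      (𝒜 := MvPolynomial.homogeneousSubmodule (Fin (d + 1 + 1)) K) w := by
    intro h
    apply hFw
    have := add_mem hcong h
    rwa [sub_add_cancel] at this
  have hℓw : ℓ t ∉ ProjectiveSpectrum.asHomogeneousIdeal
      (𝒜 := MvPolynomial.homogeneousSubmodule (Fin (d + 1 + 1)) K) w := by
    intro h
    apply hprodw
    obtain ⟨q, hq⟩ := Finset.dvd_prod_of_mem ℓ (Finset.mem_univ t)
    rw [hq]
    exact Ideal.mul_mem_right q _ h
  have hind : LinearIndependent K (Fin.snoc L (ℓ t)) :=
    linearIndependent_snoc_of_notMem_idealSpan hLind (fun h => hℓw (by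
      change ℓ t ∈ (ProjectiveSpectrum.asHomogeneousIdeal
        (𝒜 := MvPolynomial.homogeneousSubmodule (Fin (d + 1 + 1)) K) w).toIdeal
      rw [hw]; exact h))
  have hhom : ∀ k, (Fin.snoc (α := fun _ => MvPolynomial (Fin (d + 1 + 1)) K) L (ℓ t) k).IsHomogeneous 1 :=
    fun k => (MvPolynomial.mem_homogeneousSubmodule 1 _).1 (snoc_mem_grading hL (hℓ t) k)
  obtain ⟨p, hp, -, -⟩ := exists_point_of_linearIndependent (Fin.snoc L (ℓ t)) hind hhom hc
  -- `p ∈ V₊(F) = i(X)`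
  have hwp : w ⤳ p := by
    refine specializes_iff_le.2 ?_
    rw [hw, hp]
    refine Ideal.span_mono ?_
    rintro _ ⟨k, rfl⟩
    exact ⟨k.castSucc, by simp⟩
  have hFp : F ∈ ProjectiveSpectrum.asHomogeneousIdeal
      (𝒜 := MvPolynomial.homogeneousSubmodule (Fin (d + 1 + 1)) K) p := by
    have h1 : F - ∏ t, ℓ t ∈ ProjectiveSpectrum.asHomogeneousIdeal
        (𝒜 := MvPolynomial.homogeneousSubmodule (Fin (d + 1 + 1)) K) p := (specializes_iff_le.1 hwp) hcong
    have h2 : (∏ t, ℓ t) ∈ ProjectiveSpectrum.asHomogeneousIdeal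
        (𝒜 := MvPolynomial.homogeneousSubmodule (Fin (d + 1 + 1)) K) p := by
      obtain ⟨q, hq⟩ := Finset.dvd_prod_of_mem ℓ (Finset.mem_univ t)
      rw [hq]
      refine Ideal.mul_mem_right q _ ?_
      change ℓ t ∈ (ProjectiveSpectrum.asHomogeneousIdeal
        (𝒜 := MvPolynomial.homogeneousSubmodule (Fin (d + 1 + 1)) K) p).toIdeal
      rw [hp]
      exact Ideal.subset_span ⟨Fin.last c, by simp⟩
    have := add_mem h1 h2
    rwa [sub_add_cancel] at this
  have hpr : p ∈ Set.range i.left.base := by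
    rw [hrange]
    intro G hG
    rw [Set.mem_singleton_iff.1 hG]
    exact hFp
  obtain ⟨z, rfl⟩ := hpr
  exact ⟨z, hp, isLinearSubspacePoint_of_toIdeal_base_eq_span i _ hind hhom hc hp⟩

/-- **`Σ_t [Π_t] = c₁(𝒪_X(1))ᶜ ∩ [X]` in `CH_m(X)`** (`m + c = d`): when the equation of the
hypersurface `X ⊆ ℙ^{m+c+1}` splits on the linear subspace `M = V₊(L₁, …, L_c) ⊄ X` into linear
factors, `F ≡ ℓ₁ ⋯ ℓ_e mod 𝔭_M`, the classes of the `m`-planes `Π_t = M ∩ V₊(ℓ_t)` of `X` add up to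
`H_X^c ∩ [X]` (Mboro, arXiv:1701.04488, p. 8: `[S] = H_X^{n-2}` for `S = P₀ ∩ X`; here `S = Σ_t Π_t`;
e.g. three planes of a cubic cut by a `3`-plane). [cite: Mboro2018, proof of Prop. 1.4 (arXiv:1701.04488, p. 8)] [cite: Fulton1998, Prop. 2.3 (b) and Example 2.5.1 (pp. 34–41)] -/
theorem sum_mk_primeCycle_eq_hyperplaneSectionOnIter [Infinite K] {m c : ℕ} (hdim : m + c = d)
    (L : Fin c → MvPolynomial (Fin (d + 1 + 1)) K) (hL : ∀ k, L k ∈ grading (Fin (d + 1 + 1)) K 1)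
    (hLind : LinearIndependent K L)
    (hav : ∀ k, (formDivisor (L k) (hL k) (hLind.ne_zero k)).Avoids (i.left.base (genericPoint ↥X.left)))
    {w : ↥(projectiveSpace (d + 1) K).left}
    (hw : (ProjectiveSpectrum.asHomogeneousIdeal
      (𝒜 := MvPolynomial.homogeneousSubmodule (Fin (d + 1 + 1)) K) w).toIdeal = Ideal.span (Set.range L))
    (hFw : F ∉ ProjectiveSpectrum.asHomogeneousIdeal
      (𝒜 := MvPolynomial.homogeneousSubmodule (Fin (d + 1 + 1)) K) w)
    (ℓ : Fin e → MvPolynomial (Fin (d + 1 + 1)) K) (hℓ : ∀ t, ℓ t ∈ grading (Fin (d + 1 + 1)) K 1)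
    (hcong : F - ∏ t, ℓ t ∈ ProjectiveSpectrum.asHomogeneousIdeal
      (𝒜 := MvPolynomial.homogeneousSubmodule (Fin (d + 1 + 1)) K) w)
    (z : Fin e → ↥X.left) (hzm : ∀ t, height (z t) = m)
    (hz : ∀ t, (ProjectiveSpectrum.asHomogeneousIdeal
      (𝒜 := MvPolynomial.homogeneousSubmodule (Fin (d + 1 + 1)) K) (i.left.base (z t))).toIdeal =
        Ideal.span (Set.range (Fin.snoc L (ℓ t))))
    {ℓ₀ : MvPolynomial (Fin (d + 1 + 1)) K} (hℓ₀ : ℓ₀ ∈ grading (Fin (d + 1 + 1)) K 1) (hℓ₀0 : ℓ₀ ≠ 0)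
    (hX₀ : (formDivisor ℓ₀ hℓ₀ hℓ₀0).Avoids (i.left.base (genericPoint ↥X.left))) :
    ∑ t, ChowGroup.mk X.left m ⟨primeCycle (z t), primeCycle_mem_cyclesOfDim (hzm t)⟩ =
      hyperplaneSectionOnIter i hℓ₀ hℓ₀0 hX₀ m c (ChowGroup.mk X.left (m + c)
        ⟨primeCycle (genericPoint ↥X.left), primeCycle_mem_cyclesOfDim
          (by rw [height_genericPoint i hF hprime hrange]; exact_mod_cast hdim.symm)⟩) := by
  have hc : c + 1 ≤ d + 1 := by omega
  have hA := iterInter_primeCycle_eq_sum_primeCycle_of_sub_prod_mem i hF hprime hrange L hL hLind hc hav hw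
    hFw ℓ hℓ hcong z hz
  rw [← mk_iterInter_primeCycle_eq_hyperplaneSectionOnIter i hF hprime hrange hdim L hL
    (fun k => hLind.ne_zero k) hav hℓ₀ hℓ₀0 hX₀, ← map_sum]
  congr 1
  apply Subtype.ext
  rw [AddSubmonoidClass.coe_finsetSum]
  exact hA.symm

end Hypersurface

namespace ProjSpace

variable {K : Type u} [Field K] {σ : Type*}

/-- **A cubic form vanishing on two hyperplanes `V(L, ℓ)`, `V(L, ℓ')` of the linear subspace `V(L)`
splits on it: `F ≡ ℓ ℓ' q mod (L)` with `q` linear.** Precisely: if `F` is homogeneous of degree `3`,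
`F ∈ (L₁, …, L_c, ℓ)` and `F ∈ (L₁, …, L_c, ℓ')` with the latter ideal prime and not containing `ℓ`,
then `F - ℓ ℓ' q ∈ (L₁, …, L_c)` for some form `q` of degree `1` (possibly zero). Proof: `F = Σ Hₖ Lₖ
+ a ℓ` with `a` quadratic (degree-`3` parts of a representation); `a ℓ ∈ (L, ℓ')`, a prime not
containing `ℓ`, so `a ∈ (L, ℓ')`, `a = Σ cₖ Lₖ + q ℓ'` with `q` linear. [folklore] -/
theorem exists_sub_mul_mul_mem_idealSpan_of_cubic {c : ℕ} (L : Fin c → MvPolynomial σ K)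
    (hL : ∀ k, (L k).IsHomogeneous 1) {ℓ ℓ' : MvPolynomial σ K} (hℓ : ℓ.IsHomogeneous 1)
    (hℓ' : ℓ'.IsHomogeneous 1) {F : MvPolynomial σ K} (hF : F.IsHomogeneous 3)
    (h1 : F ∈ Ideal.span (Set.range (Fin.snoc L ℓ : Fin (c + 1) → MvPolynomial σ K)))
    (h2 : F ∈ Ideal.span (Set.range (Fin.snoc L ℓ' : Fin (c + 1) → MvPolynomial σ K)))
    (hprime : (Ideal.span (Set.range (Fin.snoc L ℓ' : Fin (c + 1) → MvPolynomial σ K))).IsPrime)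
    (hℓnot : ℓ ∉ Ideal.span (Set.range (Fin.snoc L ℓ' : Fin (c + 1) → MvPolynomial σ K))) :
    ∃ q : MvPolynomial σ K, q.IsHomogeneous 1 ∧ F - ℓ * ℓ' * q ∈ Ideal.span (Set.range L) := by
  have hLℓ : ∀ k, (Fin.snoc (α := fun _ => MvPolynomial σ K) L ℓ k).IsHomogeneous 1 := by
    intro k
    refine Fin.lastCases ?_ (fun j => ?_) k
    · rw [Fin.snoc_last]; exact hℓ
    · rw [Fin.snoc_castSucc]; exact hL j
  have hLℓ' : ∀ k, (Fin.snoc (α := fun _ => MvPolynomial σ K) L ℓ' k).IsHomogeneous 1 := by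
    intro k
    refine Fin.lastCases ?_ (fun j => ?_) k
    · rw [Fin.snoc_last]; exact hℓ'
    · rw [Fin.snoc_castSucc]; exact hL j
  -- `F = Σ Hₖ Lₖ + a ℓ`
  obtain ⟨H, hH, hFH⟩ := exists_eq_sum_mul_of_mem_span_of_isHomogeneous _ hLℓ h1 (by norm_num) hF
  rw [Fin.sum_univ_castSucc] at hFH
  simp only [Fin.snoc_castSucc, Fin.snoc_last] at hFH
  set a := H (Fin.last c) with ha
  have hsumL : (∑ k : Fin c, H k.castSucc * L k) ∈ Ideal.span (Set.range L) :=
    Ideal.sum_mem _ fun k _ => Ideal.mul_mem_left _ _ (Ideal.subset_span ⟨k, rfl⟩)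
  have hLle : Ideal.span (Set.range L) ≤
      Ideal.span (Set.range (Fin.snoc L ℓ' : Fin (c + 1) → MvPolynomial σ K)) := by
    refine Ideal.span_mono ?_
    rintro _ ⟨k, rfl⟩
    exact ⟨k.castSucc, by simp⟩
  -- `a ℓ ∈ (L, ℓ')`, hence `a ∈ (L, ℓ')`
  have haℓ : a * ℓ ∈ Ideal.span (Set.range (Fin.snoc L ℓ' : Fin (c + 1) → MvPolynomial σ K)) := by
    have : a * ℓ = F - ∑ k : Fin c, H k.castSucc * L k := by rw [hFH]; ring
    rw [this]
    exact sub_mem h2 (hLle hsumL)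
  have ha2 : a ∈ Ideal.span (Set.range (Fin.snoc L ℓ' : Fin (c + 1) → MvPolynomial σ K)) :=
    (hprime.mem_or_mem haℓ).resolve_right hℓnot
  -- `a = Σ cₖ Lₖ + q ℓ'`
  obtain ⟨C, hC, haC⟩ := exists_eq_sum_mul_of_mem_span_of_isHomogeneous _ hLℓ' ha2 (by norm_num) (hH _)
  rw [Fin.sum_univ_castSucc] at haC
  simp only [Fin.snoc_castSucc, Fin.snoc_last] at haC
  refine ⟨C (Fin.last c), hC _, ?_⟩
  have hsumC : (∑ k : Fin c, C k.castSucc * L k) ∈ Ideal.span (Set.range L) :=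
    Ideal.sum_mem _ fun k _ => Ideal.mul_mem_left _ _ (Ideal.subset_span ⟨k, rfl⟩)
  have key : F - ℓ * ℓ' * C (Fin.last c) =
      (∑ k : Fin c, H k.castSucc * L k) + (∑ k : Fin c, C k.castSucc * L k) * ℓ := by
    have e1 : F = (∑ k : Fin c, H k.castSucc * L k) + a * ℓ := hFH
    rw [e1, haC]
    ring
  rw [key]
  exact add_mem hsumL (Ideal.mul_mem_right _ _ hsumC)

end ProjSpace

namespace Hypersurface

variable {K : Type u} [Field K] {d e : ℕ} {X : SchemeOver K} [IsIntegral X.left]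
  [LocallyOfFiniteType X.hom] (i : X ⟶ projectiveSpace (d + 1) K) [IsClosedImmersion i.left]
  {F : MvPolynomial (Fin (d + 1 + 1)) K} (hF : F ∈ grading (Fin (d + 1 + 1)) K e) (hprime : Prime F)
  (hrange : Set.range i.left.base =
    ProjectiveSpectrum.zeroLocus (MvPolynomial.homogeneousSubmodule (Fin (d + 1 + 1)) K) {F})

open ProjSpace

include hF hprime hrange

omit [IsIntegral X.left] [LocallyOfFiniteType X.hom] [IsClosedImmersion i.left] hF hprime in
/-- The equation of `X` lies in the homogeneous prime of every point of `i(X) = V₊(F)`. [folklore] -/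
theorem mem_asHomogeneousIdeal_base (z : ↥X.left) :
    F ∈ ProjectiveSpectrum.asHomogeneousIdeal
      (𝒜 := MvPolynomial.homogeneousSubmodule (Fin (d + 1 + 1)) K) (i.left.base z) := by
  have hmem : i.left.base z ∈ Set.range i.left.base := ⟨z, rfl⟩
  rw [hrange] at hmem
  exact hmem (Set.mem_singleton F)

/-- **Three planes: `[Π] + [Π'] + [Π''] = c₁(𝒪_X(1))ᶜ ∩ [X]` for a cubic hypersurface.** Let
`X ≅ V₊(F) ⊆ ℙ^{m+c+1}` be a cubic hypersurface (`F` prime of degree `3`), `M = V₊(L₁, …, L_c)` a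
linear subspace of dimension `m + 1` not contained in `X`, and `Π = V₊(L, ℓ)`, `Π' = V₊(L, ℓ')` two
hyperplanes of `M` lying on `X` (given by points `z₁, z₂ ∈ X` over their generic points) with
`Π ⊄ Π'` (`ℓ ∉ (L, ℓ')`).
Then the cubic form splits on `M`, `F ≡ ℓ ℓ' q mod (L)` (`exists_sub_mul_mul_mem_idealSpan_of_cubic`),
the residual hyperplane `Π'' = V₊(L, q)` of `M` lies on `X` (a point `z₃ ∈ X`), and
`[Π] + [Π'] + [Π''] = c₁(𝒪_X(1))ᶜ ∩ [X]` in `CH_m(X)` (`sum_mk_primeCycle_eq_hyperplaneSectionOnIter`).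
For `m = 2` these are three planes of the cubic `X` spanning a `3`-plane, and the right side is the
class `H_X^{n-2}` of Mboro, arXiv:1701.04488, p. 8. [cite: Mboro2018, proof of Prop. 1.4 (arXiv:1701.04488, p. 8)] [cite: Fulton1998, Prop. 2.3 (b) and Example 2.5.1 (pp. 34–41)] -/
theorem exists_residual_plane_of_cubic [Infinite K] (he : e = 3) {m c : ℕ} (hdim : m + c = d)
    (L : Fin c → MvPolynomial (Fin (d + 1 + 1)) K) (hL : ∀ k, L k ∈ grading (Fin (d + 1 + 1)) K 1)
    (hLind : LinearIndependent K L)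
    (hav : ∀ k, (formDivisor (L k) (hL k) (hLind.ne_zero k)).Avoids (i.left.base (genericPoint ↥X.left)))
    {w : ↥(projectiveSpace (d + 1) K).left}
    (hw : (ProjectiveSpectrum.asHomogeneousIdeal
      (𝒜 := MvPolynomial.homogeneousSubmodule (Fin (d + 1 + 1)) K) w).toIdeal = Ideal.span (Set.range L))
    (hFw : F ∉ ProjectiveSpectrum.asHomogeneousIdeal
      (𝒜 := MvPolynomial.homogeneousSubmodule (Fin (d + 1 + 1)) K) w)
    {ℓ ℓ' : MvPolynomial (Fin (d + 1 + 1)) K} (hℓ : ℓ ∈ grading (Fin (d + 1 + 1)) K 1)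
    (hℓ' : ℓ' ∈ grading (Fin (d + 1 + 1)) K 1) (hℓℓ' : ℓ ∉ Ideal.span (Set.range (Fin.snoc L ℓ')))
    (z₁ z₂ : ↥X.left)
    (hz₁ : (ProjectiveSpectrum.asHomogeneousIdeal
      (𝒜 := MvPolynomial.homogeneousSubmodule (Fin (d + 1 + 1)) K) (i.left.base z₁)).toIdeal =
        Ideal.span (Set.range (Fin.snoc L ℓ)))
    (hz₂ : (ProjectiveSpectrum.asHomogeneousIdeal
      (𝒜 := MvPolynomial.homogeneousSubmodule (Fin (d + 1 + 1)) K) (i.left.base z₂)).toIdeal =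
        Ideal.span (Set.range (Fin.snoc L ℓ')))
    {ℓ₀ : MvPolynomial (Fin (d + 1 + 1)) K} (hℓ₀ : ℓ₀ ∈ grading (Fin (d + 1 + 1)) K 1) (hℓ₀0 : ℓ₀ ≠ 0)
    (hX₀ : (formDivisor ℓ₀ hℓ₀ hℓ₀0).Avoids (i.left.base (genericPoint ↥X.left))) :
    ∃ (q : MvPolynomial (Fin (d + 1 + 1)) K) (z₃ : ↥X.left) (h₁ : height z₁ = m) (h₂ : height z₂ = m)
      (h₃ : height z₃ = m), q ∈ grading (Fin (d + 1 + 1)) K 1 ∧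
      (ProjectiveSpectrum.asHomogeneousIdeal
        (𝒜 := MvPolynomial.homogeneousSubmodule (Fin (d + 1 + 1)) K) (i.left.base z₃)).toIdeal =
          Ideal.span (Set.range (Fin.snoc L q)) ∧
      F - ℓ * ℓ' * q ∈ Ideal.span (Set.range L) ∧
      ChowGroup.mk X.left m ⟨primeCycle z₁, primeCycle_mem_cyclesOfDim h₁⟩ +
        ChowGroup.mk X.left m ⟨primeCycle z₂, primeCycle_mem_cyclesOfDim h₂⟩ +
        ChowGroup.mk X.left m ⟨primeCycle z₃, primeCycle_mem_cyclesOfDim h₃⟩ =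
      hyperplaneSectionOnIter i hℓ₀ hℓ₀0 hX₀ m c (ChowGroup.mk X.left (m + c)
        ⟨primeCycle (genericPoint ↥X.left), primeCycle_mem_cyclesOfDim
          (by rw [height_genericPoint i hF hprime hrange]; exact_mod_cast hdim.symm)⟩) := by
  subst he
  have hc : c + 1 ≤ d + 1 := by omega
  have hhomL : ∀ k, (L k).IsHomogeneous 1 := fun k => (MvPolynomial.mem_homogeneousSubmodule 1 _).1 (hL k)
  have hhomℓ : ℓ.IsHomogeneous 1 := (MvPolynomial.mem_homogeneousSubmodule 1 _).1 hℓ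
  have hhomℓ' : ℓ'.IsHomogeneous 1 := (MvPolynomial.mem_homogeneousSubmodule 1 _).1 hℓ'
  -- the cubic splits on `M`
  have hprime₂ : (Ideal.span (Set.range (Fin.snoc L ℓ' : Fin (c + 1) → MvPolynomial (Fin (d + 1 + 1)) K))).IsPrime := by
    rw [← hz₂]
    exact (i.left.base z₂).isPrime
  have h1 : F ∈ Ideal.span (Set.range (Fin.snoc L ℓ : Fin (c + 1) → MvPolynomial (Fin (d + 1 + 1)) K)) := by
    rw [← hz₁]; exact mem_asHomogeneousIdeal_base i hrange z₁
  have h2 : F ∈ Ideal.span (Set.range (Fin.snoc L ℓ' : Fin (c + 1) → MvPolynomial (Fin (d + 1 + 1)) K)) := by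
    rw [← hz₂]; exact mem_asHomogeneousIdeal_base i hrange z₂
  obtain ⟨q, hq, hFq⟩ := exists_sub_mul_mul_mem_idealSpan_of_cubic L hhomL hhomℓ hhomℓ'
    ((MvPolynomial.mem_homogeneousSubmodule 3 _).1 hF) h1 h2 hprime₂ hℓℓ'
  have hq' : q ∈ grading (Fin (d + 1 + 1)) K 1 := (MvPolynomial.mem_homogeneousSubmodule 1 _).2 hq
  -- the family `(ℓ, ℓ', q)`
  set ℓs : Fin 3 → MvPolynomial (Fin (d + 1 + 1)) K := ![ℓ, ℓ', q] with hℓs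
  have hℓsg : ∀ t, ℓs t ∈ grading (Fin (d + 1 + 1)) K 1 := by
    intro t; fin_cases t
    · exact hℓ
    · exact hℓ'
    · exact hq'
  have hcong : F - ∏ t, ℓs t ∈ ProjectiveSpectrum.asHomogeneousIdeal
      (𝒜 := MvPolynomial.homogeneousSubmodule (Fin (d + 1 + 1)) K) w := by
    have hprod : ∏ t, ℓs t = ℓ * ℓ' * q := by
      rw [Fin.prod_univ_three]
      rfl
    rw [hprod]
    change F - ℓ * ℓ' * q ∈ (ProjectiveSpectrum.asHomogeneousIdeal
      (𝒜 := MvPolynomial.homogeneousSubmodule (Fin (d + 1 + 1)) K) w).toIdeal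
    rw [hw]
    exact hFq
  -- the residual plane `V₊(L, q)` lies on `X`
  obtain ⟨z₃, hz₃, hpl₃⟩ := exists_toIdeal_base_eq_span_snoc i hrange L hL hLind hc hw hFw ℓs hℓsg
    hcong 2
  have hz₃' : (ProjectiveSpectrum.asHomogeneousIdeal
      (𝒜 := MvPolynomial.homogeneousSubmodule (Fin (d + 1 + 1)) K) (i.left.base z₃)).toIdeal =
        Ideal.span (Set.range (Fin.snoc L q)) := hz₃
  -- dimensions
  have hm : d + 1 - (c + 1) = m := by omega
  obtain ⟨w₁, hw₁, hpl₁⟩ := exists_toIdeal_base_eq_span_snoc i hrange L hL hLind hc hw hFw ℓs hℓsg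
    hcong 0
  obtain ⟨w₂, hw₂, hpl₂⟩ := exists_toIdeal_base_eq_span_snoc i hrange L hL hLind hc hw hFw ℓs hℓsg
    hcong 1
  -- `w₁ = z₁`, `w₂ = z₂` (same image point, `i` injective)
  have e₁ : w₁ = z₁ := i.left.isClosedEmbedding.injective (ProjectiveSpectrum.ext
    (HomogeneousIdeal.toIdeal_injective (hw₁.trans hz₁.symm)))
  have e₂ : w₂ = z₂ := i.left.isClosedEmbedding.injective (ProjectiveSpectrum.ext
    (HomogeneousIdeal.toIdeal_injective (hw₂.trans hz₂.symm)))
  subst e₁ e₂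
  have h₁ : height w₁ = m := by rw [hpl₁.height_eq, hm]
  have h₂ : height w₂ = m := by rw [hpl₂.height_eq, hm]
  have h₃ : height z₃ = m := by rw [hpl₃.height_eq, hm]
  refine ⟨q, z₃, h₁, h₂, h₃, hq', hz₃', hFq, ?_⟩
  have key := sum_mk_primeCycle_eq_hyperplaneSectionOnIter i hF hprime hrange hdim L hL hLind hav hw hFw ℓs
    hℓsg hcong ![w₁, w₂, z₃] (fun t => by fin_cases t <;> assumption) (fun t => by
      fin_cases t
      · exact hw₁
      · exact hw₂
      · exact hz₃) hℓ₀ hℓ₀0 hX₀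
  rw [Fin.sum_univ_three] at key
  exact key

end Hypersurface

end Literature.AlgebraicGeometry.Motives

end
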